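import Summits.ResolutionOfSingularities.ResolutionOfSingularities.Theorems.FrobeniusClosingSteerBinaryResidueClauseFive
import Summits.ResolutionOfSingularities.ResolutionOfSingularities.Theorems.FrobeniusClosingSteerBinaryResidueAdaptedWindow
import Summits.ResolutionOfSingularities.ResolutionOfSingularities.Theorems.FrobeniusClosingSteerDivisorTriggerTwoChart
import Summits.ResolutionOfSingularities.ResolutionOfSingularities.Theorems.FrobeniusClosingSteerArithReductionLegality
import HarnessLib

/-!
# hARᵒ H2 — F3ʳᵘⁿ: **the odd-satellite assembly AT RUN LEVEL** — case (α) of the H2ₘ decomposition: three consecutive visits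
# `j₁` (an A-stage), `j₂`, `N` with `x_{j₁}` exceptional through `j₂` and a SATELLITE step `j₂ → N` (`x/x₁ ∈ 𝔪_N`) give an ON-AXIS BINARY
# datum at `j₁` in the currency of `ArithReductionLegality.arithSwitchClause_of_H2`'s binder (H2) (Theses-free, def-free)

OURS (campaign `res-hironaka`, rung L ★L-G4, slot W4.1 · crux `Steer` (stmt-ResolutionOfSingularities-16345) · hARᵒ slot H2; P0 brief
`L/res-L0-w41-plan-1/P0-BRIEF-hARo.md` b66a17a38113b83f §«Remaining objects» 4; design res-type-062 g15 `H2-DESIGN.md` 7dac75913b6b98e3 §5 (α)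
and «RUN WRAPPERS»; seat res-D-repro-2 g9, P0 main hand (res-L0-w41-plan-1 RULING 221(b)/225(a))). The run plumbing over the kernels F3
`BinaryResidue.binaryResidue_of_oddSatellite` (p547879), F5 `BinaryResidue.oddDivisor_quotient_of_oddSatellite` (p554873), F3w
`BinaryResidue.exists_adapted_window(_cons)`, `DivisorTrigger.eq_locAtCentre_blowupRing`, `VisitLawDelta.visitLaw₂_of_run` (p544279),
`VisitLawPointStep.prime_excParam_succ`. Not a statement of the manuscript under review [claim: Hironaka2017, status: under-review]; AI-produced,
weaker than expert review.

INPUTS (run words, all by name): a steered run at `p = 2` in characteristic `2` (`R 0` dominated by `O`), regular members of dimension `4`;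
visit pairs `(j₁, j₂)` and `(j₂, N)` with Hγ (only strips of the tracked parameter in between); `j₁` an A-STAGE of reduced order `d ≥ 3`
(`IsAStageAt`), reduced order `d` at `j₂` and at `N` (`HasReducedOrderAt`, S1b); `x` resp. `x₁` exceptional parameters of the point steps `j₁`
resp. `j₂`; the SATELLITE condition `x/x₁ ∈ 𝔪_{R (j₂+1)}`; N4's height-one clause at `j₂` and `N`; RATIONALITY of the two point windows in value
form (`∀ a ∈ R j₂, ∃ b ∈ R j₁, v(a − b) < 1`, idem `(N, j₂)`; Q1 of the design — a separate slot discharges it or excludes the non-rational case).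
OUTPUT: the (H2)-datum at `i := j₁`: `IsRsopPart ![m₁, m₂]`, `Ψ` homogeneous of degree `d` with `s_{j₁}² − g² − Ψ(m₁, m₂) ∈ 𝔪^(d+1)` and
`v(m₁), v(m₂) < v(x)` (ON-AXIS: the axis `V(m₁, m₂)` passes through the next centre).

CHAIN: `visitLaw₂_of_run` at `(j₁, j₂)` (`ν = d`: ring constancy `R j₂ = R (j₁+1)`, unit-cofactor law, clord `1` along `x` at `j₂` ⇒ `x` odd
divisor ⇒ `ν_{j₂} = d + 1`) and at `(j₂, N)` (`ν = d + 1`); squaring the laws (characteristic 2); the quadratic transforms in chart form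
(`eq_locAtCentre_blowupRing`) and the ADAPTED RATIONAL WINDOWS (`exists_adapted_window`, `exists_adapted_window_cons` with the prescribed satellite
parameter `x`); F5 ⇒ `x/x₁` odd divisor at `N` ⇒ (`HasReducedOrderAt` at `N`) `ν_N = d + 1`; F3 ⇒ binary on-axis residue at `j₁`;
`exists_isHomogeneous_of_mem_span_pow` converts the span-power membership into the `Ψ`-form; valuations from `m_k ∈ (u) = x·(u′)`, `u′ ⊆ 𝔪`.
The members `R j₂ = R (j₁+1)` and `R N = R (j₂+1)` are used as PLAIN Subring equalities (memberships and the cleaner are moved element-wise,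
`sub_sq_mem_pow_of_subring_eq`). [cite: Matsumura1987, Thm. 14.2] [folklore]
-/

noncomputable section

-- `Summit.<S>.<S>.…` duplicates the summit name by design (single-problem summit).
set_option linter.dupNamespace false

open IsLocalRing MvPolynomial

namespace Summit.ResolutionOfSingularities.ResolutionOfSingularities.Theorems.SwitchingDichotomy.BinaryResidue

open Literature.AlgebraicGeometry.Resolution
open Summit.ResolutionOfSingularities.ResolutionOfSingularities.Theorems.SwitchingDichotomy.Words
  (HasClordAlongAt HasCleanedOrderAt HasReducedOrderAt IsOddDivisorAt NoOddDivisorAt IsAStageAt IsSteeredRun IsVisitPair IsPointStep)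

variable {K : Type} [Field K] {O : ValuationSubring K} {R : ℕ → Subring K} {P : (i : ℕ) → Ideal (R i)} {t : K} {s : ℕ → K}

/-- Transport of a «cleaner of order `n`» along an EQUALITY of members (`R j′ = R (j+1)` is a plain Subring equality in the run; the member
words carry their own instances, so we move memberships element-wise). [folklore] -/
theorem sub_sq_mem_pow_of_subring_eq {S T : Subring K} (h : S = T) [IsLocalRing S] [IsLocalRing T] (n : ℕ) {f g : K}
    (hfS : f ∈ S) (hgS : g ∈ S) (hfT : f ∈ T) (hgT : g ∈ T)
    (hm : (⟨f, hfS⟩ : S) - ⟨g, hgS⟩ ^ 2 ∈ maximalIdeal S ^ n) : (⟨f, hfT⟩ : T) - ⟨g, hgT⟩ ^ 2 ∈ maximalIdeal T ^ n := by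
  subst h; exact hm

/-- **F3ʳᵘⁿ — an odd satellite after an A-stage forces an ON-AXIS BINARY A-stage (run level).** See the module docstring for the inputs
and the output (= the datum of `ArithReductionLegality.arithSwitchClause_of_H2`'s binder (H2) at `i := j₁`, with `u := x`).
[cite: Matsumura1987, Thm. 14.2, Thm. 17.10] [folklore] -/
theorem binaryAStage_of_oddSatellite_run [CharP K 2] (hrun : IsSteeredRun O R P t 2 s) (hR0 : SubringDominates (R 0) O.toSubring)
    (hreg : ∀ i, IsRegularLocalRing (R i)) (hdim : ∀ i, ringKrullDim (R i) = (4 : ℕ))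
    {j₁ j₂ N : ℕ} (hv₁ : IsVisitPair R P j₁ j₂) (hv₂ : IsVisitPair R P j₂ N)
    {d : ℕ} (hd : 3 ≤ d) (hA : IsAStageAt R P s 2 j₁ d)
    (hredj₂ : HasReducedOrderAt R s 2 j₂ d) (hredN : HasReducedOrderAt R s 2 N d)
    {x : K} (hx : (∃ h : x ∈ R j₁, (⟨x, h⟩ : R j₁) ∈ P j₁) ∧ x ≠ 0 ∧ ∀ y : R j₁, y ∈ P j₁ → O.valuation (y : K) ≤ O.valuation x)
    (Hγ₁ : ∀ k, j₁ < k → k < j₂ → ∃ hx : x ∈ R k, P k = Ideal.span {(⟨x, hx⟩ : R k)})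
    {x₁ : K} (hx₁ : (∃ h : x₁ ∈ R j₂, (⟨x₁, h⟩ : R j₂) ∈ P j₂) ∧ x₁ ≠ 0 ∧ ∀ y : R j₂, y ∈ P j₂ → O.valuation (y : K) ≤ O.valuation x₁)
    (Hγ₂ : ∀ k, j₂ < k → k < N → ∃ hx₁ : x₁ ∈ R k, P k = Ideal.span {(⟨x₁, hx₁⟩ : R k)})
    (hsat : ∃ h : x / x₁ ∈ R (j₂ + 1), (⟨x / x₁, h⟩ : R (j₂ + 1)) ∈ maximalIdeal (R (j₂ + 1)))
    (h1j₂ : ∀ (hs' : s j₂ ^ 2 ∈ R j₂) (Q : Ideal (R j₂)) [Q.IsPrime], Q.height = 1 →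
      ¬ SigmaTopLegality.IsSingPrime (R j₂) 2 ⟨s j₂ ^ 2, hs'⟩ Q)
    (h1N : ∀ (hs' : s N ^ 2 ∈ R N) (Q : Ideal (R N)) [Q.IsPrime], Q.height = 1 →
      ¬ SigmaTopLegality.IsSingPrime (R N) 2 ⟨s N ^ 2, hs'⟩ Q)
    (hrat₁ : ∀ a ∈ R j₂, ∃ b ∈ R j₁, O.valuation (a - b) < 1)
    (hrat₂ : ∀ a ∈ R N, ∃ b ∈ R j₂, O.valuation (a - b) < 1) :
    ∃ (_ : IsLocalRing (R j₁)) (hs : s j₁ ^ 2 ∈ R j₁) (g m₁ m₂ : R j₁) (Ψ : MvPolynomial (Fin 2) (R j₁)),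
      IsRsopPart ![m₁, m₂] ∧ Ψ.IsHomogeneous d ∧
      (⟨s j₁ ^ 2, hs⟩ : R j₁) - g ^ 2 - MvPolynomial.eval ![m₁, m₂] Ψ ∈ maximalIdeal (R j₁) ^ (d + 1) ∧
      O.valuation (m₁ : K) < O.valuation x ∧ O.valuation (m₂ : K) < O.valuation x := by
  classical
  -- members are local, regular domains, dominated by `O`
  haveI hloc : ∀ i, IsLocalRing (R i) := fun i => VisitLawPointStep.isLocalRing_of_run hrun i
  have hdom : ∀ i, SubringDominates (R i) O.toSubring := fun i => VisitLawPointStep.subringDominates_of_run hrun hR0 i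
  have hbl : ∀ i, IsLocalBlowupAlong O (R i) (P i) (R (i + 1)) := fun i => VisitLawPointStep.isLocalBlowupAlong_of_run hrun i
  obtain ⟨hpt₁, -, hdodd, hclean₁⟩ := hA
  have h2d : 2 ≤ d := by omega
  -- visit law at (j₁, j₂): ring constancy and the unit-cofactor law with `ν = d`
  obtain ⟨⟨hRj₂, G, W, hG, hW, hWinv, hW0, hlaw⟩, -, hclord⟩ :=
    VisitLawDelta.visitLaw₂_of_run hrun hR0 hv₁ hx Hγ₁ hreg h1j₂ h2d hclean₁
  -- point steps
  obtain ⟨instj₁, hPj₁⟩ := hpt₁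
  obtain ⟨instj₂, hPj₂⟩ := hv₁.2.2.1
  have hpt₂ : IsPointStep R P j₂ := hv₁.2.2.1
  -- `x` at `j₁ + 1`: regular parameter, prime
  have hx1 : x ∈ R (j₁ + 1) := (hbl j₁).isLocalBlowup.le hx.1.fst
  obtain ⟨hxm₁, hx2₁, hxprime₁⟩ := VisitLawPointStep.prime_excParam_succ hrun hR0 ⟨instj₁, hPj₁⟩ (hreg j₁) (hreg (j₁ + 1)) hx hx1
  -- `x` is an odd divisor at `j₂` (clord `d % 2 = 1`), hence `ν_{j₂} = d + 1`
  have hd2 : d % 2 = 1 := Nat.odd_iff.mp hdodd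
  rw [hd2] at hclord
  have hodd₂ : IsOddDivisorAt R s 2 j₂ x := by
    have key : ∀ (S : Subring K) (hS : S = R (j₁ + 1)) (hxS : x ∈ S) [IsLocalRing S],
        (⟨x, hxS⟩ : S) ∈ maximalIdeal S ∧ (⟨x, hxS⟩ : S) ∉ maximalIdeal S ^ 2 := by
      intro S hS hxS _; subst hS; exact ⟨hxm₁, hx2₁⟩
    obtain ⟨hm, hm2⟩ := key (R j₂) hRj₂ (hRj₂ ▸ hx1)
    exact ⟨hloc j₂, hRj₂ ▸ hx1, hm, hm2, 1, odd_one, hclord⟩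
  have hν₂ : HasCleanedOrderAt R s 2 j₂ (d + 1) := by
    obtain ⟨ν, hν, hcase⟩ := hredj₂
    rcases hcase with ⟨hno, -⟩ | ⟨-, hdν⟩
    · exact absurd hodd₂ (hno x)
    · rw [hdν]; exact hν
  -- visit law at (j₂, N) with `ν = d + 1`
  have h2d1 : 2 ≤ d + 1 := by omega
  obtain ⟨⟨hRN, G₁, W₁, hG₁, hW₁, hW₁inv, hW₁0, hlaw₂⟩, -, -⟩ :=
    VisitLawDelta.visitLaw₂_of_run hrun hR0 hv₂ hx₁ Hγ₂ hreg h1N h2d1 hν₂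
  -- `x₁` at `j₂ + 1`: regular parameter
  have hx₁1 : x₁ ∈ R (j₂ + 1) := (hbl j₂).isLocalBlowup.le hx₁.1.fst
  obtain ⟨hx₁m, hx₁2, -⟩ := VisitLawPointStep.prime_excParam_succ hrun hR0 hpt₂ (hreg j₂) (hreg (j₂ + 1)) hx₁ hx₁1
  -- the three members `S₀ = R j₁ ≤ S₁ = R (j₁+1) (= R j₂) ≤ S₂ = R (j₂+1) (= R N)`
  have h01 : R j₁ ≤ R (j₁ + 1) := (hbl j₁).isLocalBlowup.le
  have h12 : R (j₁ + 1) ≤ R (j₂ + 1) := hRj₂ ▸ (hbl j₂).isLocalBlowup.le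
  haveI := hreg j₁; haveI := hreg (j₁ + 1); haveI := hreg (j₂ + 1)
  -- domination: maximal ideal = value < 1
  have hval : ∀ i (a : R i), a ∈ maximalIdeal (R i) ↔ O.valuation (a : K) < 1 := fun i =>
    (subringDominates_valuationSubring_iff (hdom i).1).mp (hdom i)
  -- exceptional clause of `x₁` transported to `R (j₁+1)` in valuation form
  have hx₁R : x₁ ∈ R (j₁ + 1) := hRj₂ ▸ hx₁.1.fst
  have hx₁maxv : ∀ y : K, y ∈ R (j₁ + 1) → O.valuation y < 1 → O.valuation y ≤ O.valuation x₁ := by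
    have h' : ∀ y : K, y ∈ R j₂ → O.valuation y < 1 → O.valuation y ≤ O.valuation x₁ := by
      intro y hy hv
      have hm : (⟨y, hy⟩ : R j₂) ∈ maximalIdeal (R j₂) := (hval j₂ ⟨y, hy⟩).mpr hv
      exact hx₁.2.2 ⟨y, hy⟩ (hPj₂ ▸ hm)
    rw [hRj₂] at h'; exact h'
  have hx₁m' : (⟨x₁, hx₁R⟩ : R (j₁ + 1)) ∈ maximalIdeal (R (j₁ + 1)) := by
    rw [hval]
    obtain ⟨h, hP⟩ := hx₁.1
    exact (hval j₂ ⟨x₁, h⟩).mp (hPj₂ ▸ hP)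
  have hx₁max' : ∀ y : R (j₁ + 1), y ∈ maximalIdeal (R (j₁ + 1)) → O.valuation (y : K) ≤ O.valuation x₁ :=
    fun y hy => hx₁maxv y y.2 ((hval _ y).mp hy)
  -- the two quadratic transforms in chart form
  have hbl₁ : IsLocalBlowupAlong O (R j₁) (maximalIdeal (R j₁)) (R (j₁ + 1)) := by
    have h := hbl j₁; rw [hPj₁] at h; exact h
  have hxm₀ : (⟨x, hx.1.fst⟩ : R j₁) ∈ maximalIdeal (R j₁) := hPj₁ ▸ hx.1.snd
  have hxmax₀ : ∀ y : R j₁, y ∈ maximalIdeal (R j₁) → O.valuation (y : K) ≤ O.valuation x :=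
    fun y hy => hx.2.2 y (hPj₁ ▸ hy)
  have hR₁ : R (j₁ + 1) = locAtCentre (blowupRing (R j₁) x) O :=
    DivisorTrigger.eq_locAtCentre_blowupRing hbl₁ hx.1.fst hxm₀ hx.2.1 hxmax₀
  have hbl₂ : IsLocalBlowupAlong O (R (j₁ + 1)) (maximalIdeal (R (j₁ + 1))) (R (j₂ + 1)) := by
    have key : ∀ (S : Subring K) (hS : S = R j₂) [IsLocalRing S], IsLocalBlowupAlong O S (maximalIdeal S) (R (j₂ + 1)) := by
      intro S hS _; subst hS
      have h := hbl j₂; rw [hPj₂] at h; exact h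
    exact key _ hRj₂.symm
  have hR₂ : R (j₂ + 1) = locAtCentre (blowupRing (R (j₁ + 1)) x₁) O :=
    DivisorTrigger.eq_locAtCentre_blowupRing hbl₂ hx₁R hx₁m' hx₁.2.1 hx₁max'
  -- rationality in the tree's form
  have hrat₁' : ∀ a : R (j₁ + 1), ∃ b : R j₁, a - ⟨(b : K), h01 b.2⟩ ∈ maximalIdeal (R (j₁ + 1)) := by
    intro a
    have ha : (a : K) ∈ R j₂ := by rw [hRj₂]; exact a.2
    obtain ⟨b, hb, hvb⟩ := hrat₁ a ha
    exact ⟨⟨b, hb⟩, (hval _ _).mpr (by simpa using hvb)⟩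
  have hrat₂' : ∀ a : R (j₂ + 1), ∃ b : R (j₁ + 1), a - ⟨(b : K), h12 b.2⟩ ∈ maximalIdeal (R (j₂ + 1)) := by
    intro a
    have ha : (a : K) ∈ R N := by rw [hRN]; exact a.2
    obtain ⟨b, hb, hvb⟩ := hrat₂ a ha
    have hb' : b ∈ R (j₁ + 1) := by rw [← hRj₂]; exact hb
    exact ⟨⟨b, hb'⟩, (hval _ _).mpr (by simpa using hvb)⟩
  -- the windows
  have hdim₀' : ringKrullDim (R j₁) = ((3 : ℕ) + 1 : ℕ) := by rw [hdim]
  have hdim₁' : ringKrullDim (R (j₁ + 1)) = ((3 : ℕ) + 1 : ℕ) := by rw [hdim]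
  obtain ⟨u, u', hxu, hu, hm₁⟩ := exists_adapted_window (hdom j₁) (hdom (j₁ + 1)) hdim₀' ⟨x, hx.1.fst⟩ hxm₀ hx.2.1 hxmax₀
    hR₁ h01 hdim₁' hrat₁'
  have hdim₁'' : ringKrullDim (R (j₁ + 1)) = ((2 : ℕ) + 1 + 1 : ℕ) := by rw [hdim]
  have hdim₂'' : ringKrullDim (R (j₂ + 1)) = ((2 : ℕ) + 1 + 1 : ℕ) := by rw [hdim]
  have hpx : ∃ h : ((⟨x, hx1⟩ : R (j₁ + 1)) : K) / ((⟨x₁, hx₁R⟩ : R (j₁ + 1)) : K) ∈ R (j₂ + 1),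
      (⟨_, h⟩ : R (j₂ + 1)) ∈ maximalIdeal (R (j₂ + 1)) := hsat
  obtain ⟨v, v', hv0, hx₁v, hv, hm₂⟩ := exists_adapted_window_cons (hdom (j₁ + 1)) (hdom (j₂ + 1)) hdim₁'' ⟨x₁, hx₁R⟩ hx₁m'
    hx₁.2.1 hx₁max' hR₂ h12 hdim₂'' hrat₂' ⟨x, hx1⟩ hxm₁ hx2₁ hpx
  have hv0L : ((v 0 : R (j₁ + 1)) : K) = x := by rw [hv0]
  -- characteristic 2
  have h2 : (2 : K) = 0 := CharTwo.two_eq_zero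
  -- radicands as members
  obtain ⟨_, hs₁, ⟨G₀, hG₀⟩, -⟩ := hclean₁
  have hsj₂ : s j₂ ^ 2 ∈ R (j₁ + 1) := by rw [← hRj₂]; exact VisitLawPointStep.pow_mem_of_run hrun j₂
  have hGR : G ∈ R (j₁ + 1) := by rw [← hRj₂]; exact hG
  have hWR : W ∈ R (j₁ + 1) := by rw [← hRj₂]; exact hW
  have hWinvR : W⁻¹ ∈ R (j₁ + 1) := by rw [← hRj₂]; exact hWinv
  have hsN : s N ^ 2 ∈ R (j₂ + 1) := by rw [← hRN]; exact VisitLawPointStep.pow_mem_of_run hrun N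
  have hG₁R : G₁ ∈ R (j₂ + 1) := by rw [← hRN]; exact hG₁
  have hW₁R : W₁ ∈ R (j₂ + 1) := by rw [← hRN]; exact hW₁
  have hW₁invR : W₁⁻¹ ∈ R (j₂ + 1) := by rw [← hRN]; exact hW₁inv
  set f₀ : R j₁ := ⟨s j₁ ^ 2, hs₁⟩ with hf₀
  set f₁ : R (j₁ + 1) := ⟨s j₂ ^ 2, hsj₂⟩ with hf₁
  set f₂ : R (j₂ + 1) := ⟨s N ^ 2, hsN⟩ with hf₂
  have hWunit : IsUnit (⟨W, hWR⟩ : R (j₁ + 1)) := (isUnit_subring_iff_inv_mem _).mpr ⟨hW0, hWinvR⟩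
  have hW₁unit : IsUnit (⟨W₁, hW₁R⟩ : R (j₂ + 1)) := (isUnit_subring_iff_inv_mem _).mpr ⟨hW₁0, hW₁invR⟩
  -- the squared laws (characteristic 2)
  set e := (d + 1) / 2 with he
  have hde : d + 1 = 2 * e := by omega
  have hlaw₁' : ((f₁ : R (j₁ + 1)) : K) * x ^ (d - 1) * ((⟨W, hWR⟩ : R (j₁ + 1)) : K) ^ 2 =
      ((f₀ : R j₁) : K) - ((⟨G, hGR⟩ : R (j₁ + 1)) : K) ^ 2 := by
    have hm : d - 1 = 2 * (d / 2) := by omega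
    have esq := congrArg (fun z : K => z ^ 2) hlaw
    show s j₂ ^ 2 * x ^ (d - 1) * W ^ 2 = s j₁ ^ 2 - G ^ 2
    rw [hm, pow_mul]
    linear_combination esq + (G ^ 2 - s j₁ * G) * h2
  have hlaw₂' : ((f₂ : R (j₂ + 1)) : K) * x₁ ^ (d + 1) * ((⟨W₁, hW₁R⟩ : R (j₂ + 1)) : K) ^ 2 =
      ((f₁ : R (j₁ + 1)) : K) - ((⟨G₁, hG₁R⟩ : R (j₂ + 1)) : K) ^ 2 := by
    have esq := congrArg (fun z : K => z ^ 2) hlaw₂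
    show s N ^ 2 * x₁ ^ (d + 1) * W₁ ^ 2 = s j₂ ^ 2 - G₁ ^ 2
    rw [hde, pow_mul]
    linear_combination esq + (G₁ ^ 2 - s j₂ * G₁) * h2
  -- cleaned order `d + 1` at `j₂`, read in `R (j₁ + 1)`
  have hclean₁' : ∃ γ₁ : R (j₁ + 1), f₁ - γ₁ ^ 2 ∈ maximalIdeal (R (j₁ + 1)) ^ (d + 1) := by
    obtain ⟨_, hs', ⟨γ₁, hγ₁⟩, -⟩ := hν₂
    have hγR : (γ₁ : K) ∈ R (j₁ + 1) := by rw [← hRj₂]; exact γ₁.2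
    refine ⟨⟨(γ₁ : K), hγR⟩, ?_⟩
    exact sub_sq_mem_pow_of_subring_eq hRj₂ (d + 1) (VisitLawPointStep.pow_mem_of_run hrun j₂) γ₁.2 hsj₂ hγR hγ₁
  -- N4's height-one clause at `N`, read in `R (j₂ + 1)`
  have h1' : ∀ (Q : Ideal (R (j₂ + 1))) [Q.IsPrime], Q.height = 1 → ¬ SigmaTopLegality.IsSingPrime (R (j₂ + 1)) 2 f₂ Q := by
    have h := h1N
    rw [hRN] at h
    exact fun Q _ hQ => h hsN Q hQ
  -- F5: `x/x₁ = v' 0` is an odd divisor at `R (j₂ + 1)`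
  obtain ⟨hvm, hv2, hvL0, hcl1, hcl2⟩ := oddDivisor_quotient_of_oddSatellite h2 (R j₁) (R (j₁ + 1)) (R (j₂ + 1)) h01 h12
    (hreg _) (hreg _) (hdim _) (hdim _) ⟨x, hx.1.fst⟩ hx.2.1 u hxu u' hu ⟨x₁, hx₁R⟩ hx₁.2.1 v hv0L hx₁v v' hv hm₂ hde
    f₀ G₀ hG₀ f₁ ⟨G, hGR⟩ ⟨W, hWR⟩ hlaw₁' hclean₁' f₂ ⟨G₁, hG₁R⟩ ⟨W₁, hW₁R⟩ hlaw₂' hWunit hW₁unit h1'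
  have hv'x : ((v' 0 : R (j₂ + 1)) : K) = x / x₁ := by
    have h := hv 0
    rw [hv0L] at h
    rw [eq_div_iff hx₁.2.1, mul_comm]; exact h.symm
  -- hence `ν_N = d + 1`: a cleaner of order `d + 1` at `N`, read in `R (j₂ + 1)`
  have hclean₂' : ∃ γ₂ : R (j₂ + 1), f₂ - γ₂ ^ 2 ∈ maximalIdeal (R (j₂ + 1)) ^ (d + 1) := by
    have hxq : x / x₁ ∈ R (j₂ + 1) := hv'x ▸ (v' 0).2
    have hvq : v' 0 = ⟨x / x₁, hxq⟩ := Subtype.ext hv'x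
    -- odd divisor at `N` in the run words
    have hoddN : IsOddDivisorAt R s 2 N (x / x₁) := by
      have key : ∀ (S : Subring K) (hS : S = R (j₂ + 1)), ∃ (_ : IsLocalRing S) (hq : x / x₁ ∈ S),
          (⟨x / x₁, hq⟩ : S) ∈ maximalIdeal S ∧ (⟨x / x₁, hq⟩ : S) ∉ maximalIdeal S ^ 2 ∧
          ∃ k : ℕ, Odd k ∧ ∃ (hq' : x / x₁ ∈ S) (hs : s N ^ 2 ∈ S),
            (∃ g : S, (⟨s N ^ 2, hs⟩ : S) - g ^ 2 ∈ Ideal.span {(⟨x / x₁, hq'⟩ : S) ^ k}) ∧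
            ∀ g : S, (⟨s N ^ 2, hs⟩ : S) - g ^ 2 ∉ Ideal.span {(⟨x / x₁, hq'⟩ : S) ^ (k + 1)} := by
        intro S hS; subst hS
        refine ⟨hloc _, hxq, hvq ▸ hvm, hvq ▸ hv2, 1, odd_one, hxq, hsN, ?_, ?_⟩
        · rw [← hvq]; exact hcl1
        · rw [← hvq]; exact hcl2
      obtain ⟨hl, hq, hm, hm2, k, hk, hcl⟩ := key (R N) hRN
      exact ⟨hl, hq, hm, hm2, k, hk, hcl⟩
    obtain ⟨ν, hν, hcase⟩ := hredN
    have hνd : ν = d + 1 := by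
      rcases hcase with ⟨hno, -⟩ | ⟨-, hdν⟩
      · exact absurd hoddN (hno _)
      · exact hdν.symm
    subst hνd
    obtain ⟨_, hs', ⟨γ₂, hγ₂⟩, -⟩ := hν
    have hγR : (γ₂ : K) ∈ R (j₂ + 1) := by rw [← hRN]; exact γ₂.2
    refine ⟨⟨(γ₂ : K), hγR⟩, ?_⟩
    exact sub_sq_mem_pow_of_subring_eq hRN (d + 1) (VisitLawPointStep.pow_mem_of_run hrun N) γ₂.2 hsN hγR hγ₂
  -- F3: on-axis binary residue at the A-stage
  obtain ⟨σ, τ, hσu, hτu, hrsop, hmem⟩ := binaryResidue_of_oddSatellite h2 (R j₁) (R (j₁ + 1)) (R (j₂ + 1)) h01 h12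
    (hreg _) (hreg _) (hreg _) (hdim _) (hdim _) (hdim _) ⟨x, hx.1.fst⟩ hx.2.1 u hxu u' hu hm₁ hrat₁' ⟨x₁, hx₁R⟩ hx₁.2.1 v hv0L
    hx₁v v' hv hm₂ hrat₂' hde f₀ G₀ hG₀ f₁ ⟨G, hGR⟩ ⟨W, hWR⟩ hlaw₁' hclean₁' f₂ ⟨G₁, hG₁R⟩ ⟨W₁, hW₁R⟩ hlaw₂' hclean₂'
  -- the form `Ψ`
  obtain ⟨y, hy, w, hw, hyw⟩ := Submodule.mem_sup.mp hmem
  have hrange : Set.range ![σ, τ] = {σ, τ} := by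
    ext z
    simp only [Set.mem_range, Set.mem_insert_iff, Set.mem_singleton_iff, Fin.exists_fin_two, Matrix.cons_val_zero,
      Matrix.cons_val_one]
    constructor
    · rintro (h | h) <;> [exact Or.inl h.symm; exact Or.inr h.symm]
    · rintro (h | h) <;> [exact Or.inl h.symm; exact Or.inr h.symm]
  rw [← hrange] at hy
  obtain ⟨Ψ, hΨ, hΨev⟩ := exists_isHomogeneous_of_mem_span_pow ![σ, τ] d hy
  -- valuations: `σ, τ ∈ (u) = x·(u')` with `u'_j ∈ 𝔪_{R (j₁+1)}`
  have hvx0 : O.valuation x ≠ 0 := (map_ne_zero _).mpr hx.2.1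
  have hum : ∀ j, u' j ∈ maximalIdeal (R (j₁ + 1)) := fun j =>
    hm₁ ▸ Ideal.subset_span (Set.mem_insert_of_mem _ ⟨j, rfl⟩)
  have hvalu : ∀ ρ : R j₁, ρ ∈ Ideal.span (Set.range u) → O.valuation (ρ : K) < O.valuation x := by
    intro ρ hρ
    obtain ⟨c, hc⟩ := Ideal.mem_span_range_iff_exists_fun.mp hρ
    set ρ' : R (j₁ + 1) := ∑ j, ⟨(c j : K), h01 (c j).2⟩ * u' j with hρ'
    have hρ'm : ρ' ∈ maximalIdeal (R (j₁ + 1)) := Ideal.sum_mem _ fun j _ => Ideal.mul_mem_left _ _ (hum j)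
    have hρK : (ρ : K) = x * (ρ' : K) := by
      rw [← hc, hρ']
      push_cast
      rw [Finset.mul_sum]
      refine Finset.sum_congr rfl fun j _ => ?_
      rw [hu j]; ring
    have hv' : O.valuation (ρ' : K) < 1 := (hval _ ρ').mp hρ'm
    rw [hρK, map_mul]
    calc O.valuation x * O.valuation (ρ' : K) < O.valuation x * 1 := mul_lt_mul_of_pos_left hv' (pos_iff_ne_zero.mpr hvx0)
      _ = O.valuation x := mul_one _
  refine ⟨hloc j₁, hs₁, G₀, σ, τ, Ψ, hrsop, hΨ, ?_, hvalu σ hσu, hvalu τ hτu⟩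
  have : (⟨s j₁ ^ 2, hs₁⟩ : R j₁) - G₀ ^ 2 - MvPolynomial.eval ![σ, τ] Ψ = w := by
    rw [hΨev, ← hyw]; ring
  rw [this]; exact hw

end Summit.ResolutionOfSingularities.ResolutionOfSingularities.Theorems.SwitchingDichotomy.BinaryResidue

end
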